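/-
Copyright (c) 2026 the pub-hodgecm-mathlib formalisation cell (harness21).  Prover seat hodgecm-mathlib-R90-C133-p03 (g3), Track B ∕ K2-LIT ∕ R90-TF section S5
(Rogawski Ch. 13.3); deal R90-C133-plan (g2) 2026-09-05T00:41:11Z: the (A-OCC) row of ★ p863612 reduced to its three named print sub-rows, hypotheses-first.
-/
import Summits.HodgeConjecture.HodgeConjecture.Theorems.R90S5APacketGOfOneDimU   -- ★ p863612: `aPacketGOfOneDimU`, `GlobalPacketH.imageG`; brings ★ W1 `rhoXiU`, ★ FILE 2 `GlobalPacket.IsDiscrete`∕`Mem`, ★ `cmOccursInDiscreteSpectrum`, ★ (ℓ4) `UnramLaw`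
import HarnessLib

/-!
# R90-TF · S5 — `R90S5APacketDiscreteOfOccurrence`: «`Π(ξ)` IS DISCRETE» FROM ITS THREE PRINT SUB-ROWS (OCC-N) ∕ (MEM-N) ∕ (SPH-N), HYPOTHESES-FIRST
# (Rogawski 1990, §13.3 p. 201 ¶2 «`Π` will be called discrete if some member of `Π` occurs in the discrete spectrum»; Thm. 13.3.6 (b) ∕ Thm. 13.3.7)

Cell `hodgecm-mathlib`, crux H413 (`stmt-HodgeConjecture-24833`), route of record `HCCMUnconditional`; programme R90-TF, section S5 (Rogawski Ch. 13.3); deal of the S5 dealer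
R90-C133-plan (g2) 2026-09-05T00:41:11Z, hand R90-C133-p03 (g3).  `--supports stmt-HodgeConjecture-24833 --as helper`.  No instance, no notation, no named fact, no `sorry`;
NO `Lines` import (kit-generic: S5-C's `aTokOfRecord` token clause is met by the GENERIC binder `hTokN` of §3).

WHY.  ★ p863612 `aPacketGOfOneDimU h8U hunrU ξ infOf aTok hAtok hdisc` constructs the A-packet `Π(ξ)` of a one-dimensional automorphic `ξ` as a coherent type-homogeneous
discrete `G`-packet MODULO the opaque binder (A-OCC) `hdisc : (Π(rhoXiU h8U ξ)).IsDiscrete μ`.  Print's definition [§13.3 p. 201 ¶2] splits that binder into three rows the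
payers already speak:
* (OCC-N) «the family `πⁿ = (πⁿ(ξ_v))_v` OCCURS in `L²_d(G, μ)`» — `cmOccursInDiscreteSpectrum L 3 H′ μ πn` (★ F0P2-p01, relational constituent form); print: `m(⊗_v πⁿ(ξ_v)) = 1`
  [Thm. 13.3.6 (b) p. 202; Thm. 13.3.7 pp. 202–203; p. 203 ¶2]; payer = the 13.3.7 multiplicity chain (E1 ∕ S6 ∕ S5-D–S10-F);
* (MEM-N) «`πⁿ(ξ_v) ∈ Π(ξ)_v = ξ_H({ξ_v})` at every finite `v`» — `πn v ∈ (𝔩 v).mem (Π(ξ)_v)` [§13.1 Prop. 13.1.3 (d), p. 199 ¶2 «`Π(ξ) = {πⁿ(ξ), πˢ(ξ)}`»]; payer = the S4 kit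
  law ∕ (A-TOK) JQ-S5→S4-9 (§3 derives it from the record's token clause `c ∈ mem ↔ c = πⁿ ∨ πˢ = some c`);
* (SPH-N) «`πⁿ(ξ_v)` is THE unramified member `π_v⁰` for almost all `v`» [§13.3 p. 201 ¶2; §12.2 (2) p. 174: `πⁿ(ξ_v)` is unramified when `ξ_v` is]; payer = S4's (ℓ4)
  `UnramLaw` ∕ SphLaw row (§1 derives it from `K_v`-sphericality a.e. under (ℓ4)).
CONTENTS.
* §1 (ns `…F0P3GlobalPacket.GlobalPacket`, ANY packet `Π` over ANY kit family): `isDiscrete_of_mem_occurs`, `isDiscrete_of_mem_sph_occurs` (the three rows ⇒ `Π.IsDiscrete μ`),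
  `eventually_eq_sph_of_eventually_isSpherical` ((SPH) from `K_v`-sphericality a.e. under (ℓ4)), `isDiscrete_of_mem_isSpherical_occurs`, and the AUTOMORPHIC-SIDE form
  `isDiscrete_of_hasFinComponent` (a discrete `P` with irreducible admissible finite component `σ` whose local constituents lie in `Π_v` and are `π_v⁰` a.e. — print's sentence
  verbatim, via ★ `exists_cmOccursInDiscreteSpectrum_of_hasFinComponent`).
* §2 (ns `…F0P3LocalPacketKit.LocalPacketKit`): the token helpers `mem_of_forall_iff_eq_or` (`πⁿ ∈ mem P` from the A-packet clause) and `mem_of_forall_iff_eq_or_of_eq_some` (`πˢ`).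
* §3 (ns `…R90.S5`, AT `Π(ξ) = (rhoXiU h8U ξ).imageG (hunrU ξ)`): `isDiscrete_imageG_rhoXiU_of_occurs` ((OCC-N)+(MEM-N)+(SPH-N) ⇒ (A-OCC)), `…_of_isSpherical_occurs`, `…_of_tok_occurs`
  (record-token form), `…_of_hasFinComponent`; the constructor with (A-OCC) discharged `aPacketGOfOneDimU_ofOccurs` + `rfl` read-backs and the membership `πn ∈ Π(ξ)`.
HONEST LABEL: S-sized plumbing — it re-expresses one hypothesis as three and proves no occurrence; REL ≠ ★ ≠ BUILT; HC_CM is proved only modulo the 7 printed citations (2 remaining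
named inputs: hLiu418 = stmt-HodgeConjecture-24832, h413 = stmt-HodgeConjecture-24833) until rung 0 closes.

## References
* [Rogawski1990] J. D. Rogawski, *Automorphic Representations of Unitary Groups in Three Variables*, Ann. of Math. Stud. 123 (1990), §12.2 (2) p. 174; §13.1 p. 199 ¶2,
  Prop. 13.1.3 (d); §13.3 p. 201 ¶2, Thm. 13.3.6 (b) p. 202, Thm. 13.3.7 pp. 202–203, p. 203 ¶2 and l. 1–3.
* [FlathCorvallis1979] D. Flath, *Decomposition of representations into tensor products*, Proc. Sympos. Pure Math. 33.1 (1979), Thm. 3.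
* [BorelJacquetCorvallis1979] A. Borel, H. Jacquet, *Automorphic forms and automorphic representations*, Proc. Sympos. Pure Math. 33.1 (1979), §4.6.
-/

set_option autoImplicit false
set_option linter.dupNamespace false -- the mandated namespace repeats `HodgeConjecture.HodgeConjecture`, as in every sibling `R90S5*` file

noncomputable section

open NumberField IsDedekindDomain MeasureTheory Filter
open scoped Matrix
open Literature.NumberTheory Literature.NumberTheory.Automorphic Literature.NumberTheory.Automorphic.UnitaryGroup
open Literature.NumberTheory.Rogawski1990 Literature.NumberTheory.GaloisRepresentations

/-! ## §1 Generic: a packet with an occurring member family is discrete [§13.3 p. 201 ¶2] -/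

namespace Summit.HodgeConjecture.HodgeConjecture.Cruxes.H413.F0P3GlobalPacket.GlobalPacket

open Summit.HodgeConjecture.HodgeConjecture.Cruxes.H413.F0P3LocalPacketKit
open Summit.HodgeConjecture.HodgeConjecture.Cruxes.H413.F0P3GlobalPacketDiscrete

variable {L : Type} [Field L] [NumberField L] [IsCMField L] {H' : Matrix (Fin 3) (Fin 3) L}
  {𝔩 : ∀ v : HeightOneSpectrum (𝓞 ↥(maximalRealSubfield L)), LocalPacketKit L H' v}
  {μ : Measure (adelicGroupData (↥(maximalRealSubfield L)) L (IsCMField.complexConj L) 3 H').automorphicQuotient}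
  [SMulInvariantMeasure (adelicGroupData (↥(maximalRealSubfield L)) L (IsCMField.complexConj L) 3 H').Adelic
    (adelicGroupData (↥(maximalRealSubfield L)) L (IsCMField.complexConj L) 3 H').automorphicQuotient μ]

/-- **A packet with an OCCURRING MEMBER is discrete** — print's definition read forwards: `π ∈ Π` (★ FILE 2 `Mem`) and «`π` occurs in the discrete spectrum»
(★ `cmOccursInDiscreteSpectrum`) give `Π.IsDiscrete μ` (the anonymous constructor, named for citation). [cite: Rogawski1990, §13.3 p. 201 ¶2, p. 203 ¶2] -/
theorem isDiscrete_of_mem_occurs (Pg : GlobalPacket 𝔩)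
    {π : ∀ v : HeightOneSpectrum (𝓞 ↥(maximalRealSubfield L)), IrrClass ((UnitaryGroup.cmDatum L 3 H').Local v)}
    (hπ : Pg.Mem π) (hocc : cmOccursInDiscreteSpectrum L 3 H' μ π) : Pg.IsDiscrete μ :=
  ⟨π, hπ, hocc⟩

/-- **THE THREE ROWS ⇒ DISCRETE**: a family `π = (π_v)_v` with (MEM) `π_v ∈ Π_v` at every finite place, (SPH) `π_v = π_v⁰` (the kit's unramified member `sph`) for almost
all `v`, and (OCC) `π` occurring in `L²_d(G, μ)`, makes `Π` discrete. [cite: Rogawski1990, §13.3 p. 201 ¶2, p. 203 ¶2 and l. 3] -/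
theorem isDiscrete_of_mem_sph_occurs (Pg : GlobalPacket 𝔩)
    (π : ∀ v : HeightOneSpectrum (𝓞 ↥(maximalRealSubfield L)), IrrClass ((UnitaryGroup.cmDatum L 3 H').Local v))
    (hmem : ∀ v, π v ∈ (𝔩 v).mem (Pg.loc v))
    (hsph : ∀ᶠ v in cofinite, ∃ h : (𝔩 v).unr (Pg.loc v), π v = (𝔩 v).sph (Pg.loc v) h)
    (hocc : cmOccursInDiscreteSpectrum L 3 H' μ π) : Pg.IsDiscrete μ :=
  ⟨π, ⟨hmem, hsph⟩, hocc⟩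

/-- **(SPH) FROM `K_v`-SPHERICALITY A.E. UNDER (ℓ4)**: if the kit satisfies ★ FILE 1's `UnramLaw` at every place, a family of members `π_v ∈ Π_v` that is `K_v`-spherical
(`K_v = cmLocalIntegralLevel L 3 H′ v`) for almost all `v` IS the unramified member `π_v⁰ = sph Π_v` for almost all `v` — by the uniqueness clause of (ℓ4) at the (cofinitely
many) places where `Π_v` is unramified (`Π.cofinite_unr`). [cite: Rogawski1990, §13.3 p. 201 ¶2, p. 203 l. 3; §4.5 p. 45] -/
theorem eventually_eq_sph_of_eventually_isSpherical (Pg : GlobalPacket 𝔩)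
    (h𝔩 : ∀ v : HeightOneSpectrum (𝓞 ↥(maximalRealSubfield L)), (𝔩 v).UnramLaw)
    (π : ∀ v : HeightOneSpectrum (𝓞 ↥(maximalRealSubfield L)), IrrClass ((UnitaryGroup.cmDatum L 3 H').Local v))
    (hmem : ∀ v, π v ∈ (𝔩 v).mem (Pg.loc v))
    (hsph : ∀ᶠ v in cofinite, (π v).IsSpherical (cmLocalIntegralLevel L 3 H' v)) :
    ∀ᶠ v in cofinite, ∃ h : (𝔩 v).unr (Pg.loc v), π v = (𝔩 v).sph (Pg.loc v) h := by
  filter_upwards [Pg.cofinite_unr, hsph] with v hu hs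
  exact ⟨hu, LocalPacketKit.UnramLaw.eq_sph_of_isSpherical (𝔩 v) (h𝔩 v) (Pg.loc v) hu (π v) (hmem v) hs⟩

/-- **THE THREE ROWS ⇒ DISCRETE, (SPH) IN ITS SPHERICAL FORM**: under (ℓ4) everywhere, (MEM) + «`π_v` is `K_v`-spherical a.e.» + (OCC) make `Π` discrete.
[cite: Rogawski1990, §13.3 p. 201 ¶2, p. 203 ¶2 and l. 3; §12.2 (2) p. 174] -/
theorem isDiscrete_of_mem_isSpherical_occurs (Pg : GlobalPacket 𝔩)
    (h𝔩 : ∀ v : HeightOneSpectrum (𝓞 ↥(maximalRealSubfield L)), (𝔩 v).UnramLaw)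
    (π : ∀ v : HeightOneSpectrum (𝓞 ↥(maximalRealSubfield L)), IrrClass ((UnitaryGroup.cmDatum L 3 H').Local v))
    (hmem : ∀ v, π v ∈ (𝔩 v).mem (Pg.loc v))
    (hsph : ∀ᶠ v in cofinite, (π v).IsSpherical (cmLocalIntegralLevel L 3 H' v))
    (hocc : cmOccursInDiscreteSpectrum L 3 H' μ π) : Pg.IsDiscrete μ :=
  Pg.isDiscrete_of_mem_sph_occurs π hmem (Pg.eventually_eq_sph_of_eventually_isSpherical h𝔩 π hmem hsph) hocc

/-- **DISCRETENESS FROM THE AUTOMORPHIC SIDE (print's sentence verbatim)**: if a discrete automorphic `P` of `U(H′)` has an irreducible admissible finite component `σ`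
(★ `HasFinComponent`) whose local constituent class at every finite place `v` (read in the `cmDatum` model along ★ `localPiEquiv`) lies in `Π_v`, and is the unramified
member `π_v⁰` for almost all `v`, then `Π` is discrete — the occurring family is THE constituent family of `σ` (★ `exists_cmOccursInDiscreteSpectrum_of_hasFinComponent`,
Flath: one constituent class per place). [cite: Rogawski1990, §13.3 p. 201 ¶2] [cite: FlathCorvallis1979, Thm. 3] [cite: BorelJacquetCorvallis1979, §4.6] -/
theorem isDiscrete_of_hasFinComponent (Pg : GlobalPacket 𝔩)
    (P : DiscreteAutomorphicRep (adelicGroupData (↥(maximalRealSubfield L)) L (IsCMField.complexConj L) 3 H') μ)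
    {W : Type} [AddCommGroup W] [Module ℂ W] {σ : Representation ℂ (finAdelic (↥(maximalRealSubfield L)) L (IsCMField.complexConj L) 3 H') W}
    (hirr : σ.IsIrreducible) (hadm : σ.IsAdmissible) (hP : P.HasFinComponent σ)
    (hmem : ∀ (v : HeightOneSpectrum (𝓞 ↥(maximalRealSubfield L))) (c₀ : IrrClass ((UnitaryGroup.cmDatum L 3 H').Local v)),
      (IrrClass.comap (localPiEquiv L (IsCMField.complexConj L) 3 H' v) c₀).IsConstituentOf
          (σ.comp (inclPlace (↥(maximalRealSubfield L)) L (IsCMField.complexConj L) 3 H' v)) → c₀ ∈ (𝔩 v).mem (Pg.loc v))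
    (hsph : ∀ᶠ v : HeightOneSpectrum (𝓞 ↥(maximalRealSubfield L)) in cofinite, ∃ h : (𝔩 v).unr (Pg.loc v),
      (IrrClass.comap (localPiEquiv L (IsCMField.complexConj L) 3 H' v) ((𝔩 v).sph (Pg.loc v) h)).IsConstituentOf
          (σ.comp (inclPlace (↥(maximalRealSubfield L)) L (IsCMField.complexConj L) 3 H' v))) :
    Pg.IsDiscrete μ := by
  obtain ⟨π, hocc, hπ⟩ := exists_cmOccursInDiscreteSpectrum_of_hasFinComponent L 3 H' μ P hirr hadm hP
  refine Pg.isDiscrete_of_mem_sph_occurs π (fun v => hmem v (π v) ((hπ v (π v)).2 rfl)) ?_ hocc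
  filter_upwards [hsph] with v hv
  obtain ⟨h, hc⟩ := hv
  exact ⟨h, ((hπ v _).1 hc).symm⟩

end Summit.HodgeConjecture.HodgeConjecture.Cruxes.H413.F0P3GlobalPacket.GlobalPacket

/-! ## §2 Token helpers: members of a packet pinned by the A-packet clause `c ∈ mem P ↔ c = πⁿ ∨ πˢ = some c` [Prop. 13.1.3 (d) p. 199] -/

namespace Summit.HodgeConjecture.HodgeConjecture.Cruxes.H413.F0P3LocalPacketKit.LocalPacketKit

variable {L : Type} [Field L] [NumberField L] [IsCMField L] {H' : Matrix (Fin 3) (Fin 3) L}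
  {v : HeightOneSpectrum (𝓞 ↥(maximalRealSubfield L))}

/-- **`πⁿ ∈ Π(ξ)_v` FROM THE TOKEN CLAUSE**: if the members of `P` are exactly `{a} ∪ s` in the (ℓ6) ∕ `aTokOfRecord` shape `∀ c, c ∈ mem P ↔ (c = a ∨ s = some c)`, then
`a ∈ mem P`. [cite: Rogawski1990, §13.1 Prop. 13.1.3 (d) p. 199; §13.2 p. 200] -/
theorem mem_of_forall_iff_eq_or (𝔩 : LocalPacketKit L H' v) {P : 𝔩.Pkt} {a : IrrClass ((UnitaryGroup.cmDatum L 3 H').Local v)}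
    {s : Option (IrrClass ((UnitaryGroup.cmDatum L 3 H').Local v))}
    (hiff : ∀ c : IrrClass ((UnitaryGroup.cmDatum L 3 H').Local v), c ∈ 𝔩.mem P ↔ (c = a ∨ s = some c)) : a ∈ 𝔩.mem P :=
  (hiff a).2 (Or.inl rfl)

/-- **`πˢ ∈ Π(ξ)_v` FROM THE TOKEN CLAUSE** (non-split places, where `πˢ(ξ_v)` exists: `s = some b`). [cite: Rogawski1990, §13.1 Prop. 13.1.3 (d) p. 199] -/
theorem mem_of_forall_iff_eq_or_of_eq_some (𝔩 : LocalPacketKit L H' v) {P : 𝔩.Pkt} {a b : IrrClass ((UnitaryGroup.cmDatum L 3 H').Local v)}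
    {s : Option (IrrClass ((UnitaryGroup.cmDatum L 3 H').Local v))}
    (hiff : ∀ c : IrrClass ((UnitaryGroup.cmDatum L 3 H').Local v), c ∈ 𝔩.mem P ↔ (c = a ∨ s = some c)) (hs : s = some b) : b ∈ 𝔩.mem P :=
  (hiff b).2 (Or.inr hs)

end Summit.HodgeConjecture.HodgeConjecture.Cruxes.H413.F0P3LocalPacketKit.LocalPacketKit

/-! ## §3 At `Π(ξ)`: (OCC-N) + (MEM-N) + (SPH-N) ⇒ (A-OCC), and the constructor with (A-OCC) discharged [p. 201 ¶2; Thm. 13.3.6 (b); Thm. 13.3.7] -/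

namespace Summit.HodgeConjecture.HodgeConjecture.R90.S5

open Summit.HodgeConjecture.HodgeConjecture.Cruxes.H413
open Summit.HodgeConjecture.HodgeConjecture.Cruxes.H413.F0P3LocalPacketKit
open Summit.HodgeConjecture.HodgeConjecture.Cruxes.H413.F0P3GlobalPacket
open Summit.HodgeConjecture.HodgeConjecture.Cruxes.H413.F0P3GlobalPacketDiscrete
open Summit.HodgeConjecture.HodgeConjecture.Cruxes.H413.F0P3ArchPacketKit
open Summit.HodgeConjecture.HodgeConjecture.Cruxes.H413.F0P3SpectralPacket

section APacketOcc

variable {L : Type} [Field L] [NumberField L] [IsCMField L] {H' : Matrix (Fin 3) (Fin 3) L}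
  {𝔩 : ∀ v : HeightOneSpectrum (𝓞 ↥(maximalRealSubfield L)), LocalPacketKit L H' v} {𝔞 : ArchPacketKit}
  {μ : Measure (adelicGroupData (↥(maximalRealSubfield L)) L (IsCMField.complexConj L) 3 H').automorphicQuotient}
  [SMulInvariantMeasure (adelicGroupData (↥(maximalRealSubfield L)) L (IsCMField.complexConj L) 3 H').Adelic
    (adelicGroupData (↥(maximalRealSubfield L)) L (IsCMField.complexConj L) 3 H').automorphicQuotient μ]
  (h8U : ∀ v : HeightOneSpectrum (𝓞 ↥(maximalRealSubfield L)), (𝔩 v).OneDimHLawU)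
  (hunrU : ∀ ξ : OneDimAutRepH L, ∀ᶠ v : HeightOneSpectrum (𝓞 ↥(maximalRealSubfield L)) in cofinite,
    (𝔩 v).unr ((𝔩 v).xiH ((GlobalPacketH.rhoXiU h8U ξ).loc v)))
  (ξ : OneDimAutRepH L)

/-- **(OCC-N) + (MEM-N) + (SPH-N) ⇒ (A-OCC) AT `Π(ξ)`**: a family `πn = (πⁿ_v)_v` of classes of `G_v` with (MEM-N) `πⁿ_v ∈ Π(ξ)_v = ξ_H((rhoXiU h8U ξ)_v)` at every finite
place, (SPH-N) `πⁿ_v = ` the unramified member of `Π(ξ)_v` for almost all `v`, and (OCC-N) `πn` occurring in `L²_d(G, μ)`, discharges ★ p863612's binder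
`hdisc : (Π(rhoXiU h8U ξ)).IsDiscrete μ`.  Print: `π = ⊗_v πⁿ(ξ_v)` has `m(π) = 1`. [cite: Rogawski1990, §13.3 p. 201 ¶2, Thm. 13.3.6 (b) p. 202, Thm. 13.3.7 pp. 202–203; §13.1 p. 199 ¶2] -/
theorem isDiscrete_imageG_rhoXiU_of_occurs
    (πn : ∀ v : HeightOneSpectrum (𝓞 ↥(maximalRealSubfield L)), IrrClass ((cmDatum L 3 H').Local v))
    (hmemN : ∀ v : HeightOneSpectrum (𝓞 ↥(maximalRealSubfield L)), πn v ∈ (𝔩 v).mem ((𝔩 v).xiH ((GlobalPacketH.rhoXiU h8U ξ).loc v)))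
    (hsphN : ∀ᶠ v : HeightOneSpectrum (𝓞 ↥(maximalRealSubfield L)) in cofinite, ∃ h : (𝔩 v).unr ((𝔩 v).xiH ((GlobalPacketH.rhoXiU h8U ξ).loc v)),
      πn v = (𝔩 v).sph ((𝔩 v).xiH ((GlobalPacketH.rhoXiU h8U ξ).loc v)) h)
    (hoccN : cmOccursInDiscreteSpectrum L 3 H' μ πn) :
    ((GlobalPacketH.rhoXiU h8U ξ).imageG (hunrU ξ)).IsDiscrete μ :=
  ((GlobalPacketH.rhoXiU h8U ξ).imageG (hunrU ξ)).isDiscrete_of_mem_sph_occurs πn hmemN hsphN hoccN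

/-- **The same with (SPH-N) in its SPHERICAL form** «`πⁿ_v` is `K_v`-spherical for almost all `v`» [§12.2 (2) p. 174: `πⁿ(ξ_v)` is unramified where `ξ_v` is], under (ℓ4)
`UnramLaw` at every place (the S4 law row). [cite: Rogawski1990, §13.3 p. 201 ¶2, p. 203 l. 3; §12.2 (2) p. 174] -/
theorem isDiscrete_imageG_rhoXiU_of_isSpherical_occurs
    (h𝔩 : ∀ v : HeightOneSpectrum (𝓞 ↥(maximalRealSubfield L)), (𝔩 v).UnramLaw)
    (πn : ∀ v : HeightOneSpectrum (𝓞 ↥(maximalRealSubfield L)), IrrClass ((cmDatum L 3 H').Local v))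
    (hmemN : ∀ v : HeightOneSpectrum (𝓞 ↥(maximalRealSubfield L)), πn v ∈ (𝔩 v).mem ((𝔩 v).xiH ((GlobalPacketH.rhoXiU h8U ξ).loc v)))
    (hsphN : ∀ᶠ v : HeightOneSpectrum (𝓞 ↥(maximalRealSubfield L)) in cofinite, (πn v).IsSpherical (cmLocalIntegralLevel L 3 H' v))
    (hoccN : cmOccursInDiscreteSpectrum L 3 H' μ πn) :
    ((GlobalPacketH.rhoXiU h8U ξ).imageG (hunrU ξ)).IsDiscrete μ :=
  ((GlobalPacketH.rhoXiU h8U ξ).imageG (hunrU ξ)).isDiscrete_of_mem_isSpherical_occurs h𝔩 πn hmemN hsphN hoccN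

/-- **(MEM-N) FROM THE RECORD'S TOKEN CLAUSE**: if at every place the members of `Π(ξ)_v` are exactly `{πⁿ_v} ∪ πˢ_v` (S5-C's `aTokOfRecord` membership clause, ★ (ℓ6)
`ContainsAPacket` shape: `∀ c, c ∈ mem (Π(ξ)_v) ↔ (c = πn v ∨ πs v = some c)`), then `πⁿ_v ∈ Π(ξ)_v`. [cite: Rogawski1990, §13.1 Prop. 13.1.3 (d) p. 199; §13.2 p. 200] -/
theorem mem_imageG_rhoXiU_of_tok
    (πn : ∀ v : HeightOneSpectrum (𝓞 ↥(maximalRealSubfield L)), IrrClass ((cmDatum L 3 H').Local v))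
    (πs : ∀ v : HeightOneSpectrum (𝓞 ↥(maximalRealSubfield L)), Option (IrrClass ((cmDatum L 3 H').Local v)))
    (hTokN : ∀ (v : HeightOneSpectrum (𝓞 ↥(maximalRealSubfield L))) (c : IrrClass ((cmDatum L 3 H').Local v)),
      c ∈ (𝔩 v).mem ((𝔩 v).xiH ((GlobalPacketH.rhoXiU h8U ξ).loc v)) ↔ (c = πn v ∨ πs v = some c))
    (v : HeightOneSpectrum (𝓞 ↥(maximalRealSubfield L))) :
    πn v ∈ (𝔩 v).mem ((𝔩 v).xiH ((GlobalPacketH.rhoXiU h8U ξ).loc v)) :=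
  (𝔩 v).mem_of_forall_iff_eq_or (hTokN v)

/-- **RECORD-TOKEN FORM of (A-OCC)**: the token clause (⇒ (MEM-N)) + (SPH-N) + (OCC-N) make `Π(ξ)` discrete.
[cite: Rogawski1990, §13.3 p. 201 ¶2, Thm. 13.3.6 (b) p. 202; §13.1 Prop. 13.1.3 (d) p. 199] -/
theorem isDiscrete_imageG_rhoXiU_of_tok_occurs
    (πn : ∀ v : HeightOneSpectrum (𝓞 ↥(maximalRealSubfield L)), IrrClass ((cmDatum L 3 H').Local v))
    (πs : ∀ v : HeightOneSpectrum (𝓞 ↥(maximalRealSubfield L)), Option (IrrClass ((cmDatum L 3 H').Local v)))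
    (hTokN : ∀ (v : HeightOneSpectrum (𝓞 ↥(maximalRealSubfield L))) (c : IrrClass ((cmDatum L 3 H').Local v)),
      c ∈ (𝔩 v).mem ((𝔩 v).xiH ((GlobalPacketH.rhoXiU h8U ξ).loc v)) ↔ (c = πn v ∨ πs v = some c))
    (hsphN : ∀ᶠ v : HeightOneSpectrum (𝓞 ↥(maximalRealSubfield L)) in cofinite, ∃ h : (𝔩 v).unr ((𝔩 v).xiH ((GlobalPacketH.rhoXiU h8U ξ).loc v)),
      πn v = (𝔩 v).sph ((𝔩 v).xiH ((GlobalPacketH.rhoXiU h8U ξ).loc v)) h)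
    (hoccN : cmOccursInDiscreteSpectrum L 3 H' μ πn) :
    ((GlobalPacketH.rhoXiU h8U ξ).imageG (hunrU ξ)).IsDiscrete μ :=
  isDiscrete_imageG_rhoXiU_of_occurs h8U hunrU ξ πn (mem_imageG_rhoXiU_of_tok h8U ξ πn πs hTokN) hsphN hoccN

/-- **(A-OCC) FROM THE AUTOMORPHIC SIDE**: a discrete automorphic `P` of `U(H′)` with irreducible admissible finite component `σ` whose local constituent classes lie in
`Π(ξ)_v` at every finite place and are the unramified member of `Π(ξ)_v` for almost all `v` makes `Π(ξ)` discrete (print: «some member of `Π(ξ)` occurs in the discrete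
spectrum» witnessed by `P`). [cite: Rogawski1990, §13.3 p. 201 ¶2, Thm. 13.3.6 (b) p. 202] [cite: FlathCorvallis1979, Thm. 3] -/
theorem isDiscrete_imageG_rhoXiU_of_hasFinComponent
    (P : DiscreteAutomorphicRep (adelicGroupData (↥(maximalRealSubfield L)) L (IsCMField.complexConj L) 3 H') μ)
    {W : Type} [AddCommGroup W] [Module ℂ W] {σ : Representation ℂ (finAdelic (↥(maximalRealSubfield L)) L (IsCMField.complexConj L) 3 H') W}
    (hirr : σ.IsIrreducible) (hadm : σ.IsAdmissible) (hP : P.HasFinComponent σ)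
    (hmem : ∀ (v : HeightOneSpectrum (𝓞 ↥(maximalRealSubfield L))) (c₀ : IrrClass ((cmDatum L 3 H').Local v)),
      (IrrClass.comap (localPiEquiv L (IsCMField.complexConj L) 3 H' v) c₀).IsConstituentOf
          (σ.comp (inclPlace (↥(maximalRealSubfield L)) L (IsCMField.complexConj L) 3 H' v)) →
        c₀ ∈ (𝔩 v).mem ((𝔩 v).xiH ((GlobalPacketH.rhoXiU h8U ξ).loc v)))
    (hsph : ∀ᶠ v : HeightOneSpectrum (𝓞 ↥(maximalRealSubfield L)) in cofinite, ∃ h : (𝔩 v).unr ((𝔩 v).xiH ((GlobalPacketH.rhoXiU h8U ξ).loc v)),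
      (IrrClass.comap (localPiEquiv L (IsCMField.complexConj L) 3 H' v) ((𝔩 v).sph ((𝔩 v).xiH ((GlobalPacketH.rhoXiU h8U ξ).loc v)) h)).IsConstituentOf
          (σ.comp (inclPlace (↥(maximalRealSubfield L)) L (IsCMField.complexConj L) 3 H' v))) :
    ((GlobalPacketH.rhoXiU h8U ξ).imageG (hunrU ξ)).IsDiscrete μ :=
  ((GlobalPacketH.rhoXiU h8U ξ).imageG (hunrU ξ)).isDiscrete_of_hasFinComponent P hirr hadm hP hmem hsph

variable (infOf : GlobalPacket 𝔩 → 𝔞.PktInf) (aTok : ∀ v : HeightOneSpectrum (𝓞 ↥(maximalRealSubfield L)), Set (𝔩 v).Pkt)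
  (hAtok : ∀ v : HeightOneSpectrum (𝓞 ↥(maximalRealSubfield L)), (𝔩 v).xiH ((GlobalPacketH.rhoXiU h8U ξ).loc v) ∈ aTok v)
  (πn : ∀ v : HeightOneSpectrum (𝓞 ↥(maximalRealSubfield L)), IrrClass ((cmDatum L 3 H').Local v))
  (hmemN : ∀ v : HeightOneSpectrum (𝓞 ↥(maximalRealSubfield L)), πn v ∈ (𝔩 v).mem ((𝔩 v).xiH ((GlobalPacketH.rhoXiU h8U ξ).loc v)))
  (hsphN : ∀ᶠ v : HeightOneSpectrum (𝓞 ↥(maximalRealSubfield L)) in cofinite, ∃ h : (𝔩 v).unr ((𝔩 v).xiH ((GlobalPacketH.rhoXiU h8U ξ).loc v)),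
    πn v = (𝔩 v).sph ((𝔩 v).xiH ((GlobalPacketH.rhoXiU h8U ξ).loc v)) h)
  (hoccN : cmOccursInDiscreteSpectrum L 3 H' μ πn)

/-- **`aPacketGOfOneDimU_ofOccurs` — ★ p863612's `Π(ξ)` WITH (A-OCC) DISCHARGED by (OCC-N) + (MEM-N) + (SPH-N)**: the coherent type-homogeneous discrete `G`-packet
`aPacketGOfOneDimU h8U hunrU ξ infOf aTok hAtok hdisc` at `hdisc := isDiscrete_imageG_rhoXiU_of_occurs …`.  Remaining named rows: (A-TOK) `hAtok`, (ℓ8ᵁ) `h8U`, `hunrU`,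
and the three sub-rows. [cite: Rogawski1990, §13.1 p. 199 ¶2; §13.3 p. 201 ll. 10–18, Thm. 13.3.6 (b) p. 202, Thm. 13.3.7 pp. 202–203] -/
def aPacketGOfOneDimU_ofOccurs : SpectralPacketG.HomogPacketG 𝔩 𝔞 μ infOf aTok :=
  aPacketGOfOneDimU h8U hunrU ξ infOf aTok hAtok (isDiscrete_imageG_rhoXiU_of_occurs h8U hunrU ξ πn hmemN hsphN hoccN)

/-- `aPacketGOfOneDimU_ofOccurs …` IS `aPacketGOfOneDimU … hdisc` for every `hdisc` (proof irrelevance; `rfl`) — every ★ p863612 theorem applies verbatim.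
[cite: Rogawski1990, §13.3 p. 201 ll. 16–18] -/
theorem aPacketGOfOneDimU_ofOccurs_eq (hdisc : ((GlobalPacketH.rhoXiU h8U ξ).imageG (hunrU ξ)).IsDiscrete μ) :
    aPacketGOfOneDimU_ofOccurs h8U hunrU ξ infOf aTok hAtok πn hmemN hsphN hoccN = aPacketGOfOneDimU h8U hunrU ξ infOf aTok hAtok hdisc :=
  rfl

/-- The finite part of `aPacketGOfOneDimU_ofOccurs …` is `Π(rhoXiU h8U ξ)` (`rfl`). [cite: Rogawski1990, §13.3 p. 201 ll. 16–18] -/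
@[simp] theorem aPacketGOfOneDimU_ofOccurs_fin :
    (aPacketGOfOneDimU_ofOccurs h8U hunrU ξ infOf aTok hAtok πn hmemN hsphN hoccN).1.fin = (GlobalPacketH.rhoXiU h8U ξ).imageG (hunrU ξ) :=
  rfl

/-- Placewise: `Π(ξ)_v = ξ_H((rhoXiU h8U ξ)_v)` (`rfl`). [cite: Rogawski1990, §13.1 p. 199 ¶2] -/
@[simp] theorem aPacketGOfOneDimU_ofOccurs_fin_loc (v : HeightOneSpectrum (𝓞 ↥(maximalRealSubfield L))) :
    (aPacketGOfOneDimU_ofOccurs h8U hunrU ξ infOf aTok hAtok πn hmemN hsphN hoccN).1.fin.loc v = (𝔩 v).xiH ((GlobalPacketH.rhoXiU h8U ξ).loc v) :=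
  rfl

/-- The archimedean packet of `aPacketGOfOneDimU_ofOccurs …` is `infOf` of its finite part (`rfl`). [cite: Rogawski1990, §13.3 Thm. 13.3.5 p. 202] -/
@[simp] theorem aPacketGOfOneDimU_ofOccurs_inf :
    (aPacketGOfOneDimU_ofOccurs h8U hunrU ξ infOf aTok hAtok πn hmemN hsphN hoccN).1.inf = infOf ((GlobalPacketH.rhoXiU h8U ξ).imageG (hunrU ξ)) :=
  rfl

/-- **`πn` IS A MEMBER of `Π(ξ)`** (★ FILE 2 `Mem`: (MEM-N) + (SPH-N)). [cite: Rogawski1990, §13.3 p. 201 ¶2, p. 203 ¶2] -/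
theorem mem_aPacketGOfOneDimU_ofOccurs : (aPacketGOfOneDimU_ofOccurs h8U hunrU ξ infOf aTok hAtok πn hmemN hsphN hoccN).1.fin.Mem πn :=
  ⟨hmemN, hsphN⟩

/-- **The occurring member witnesses discreteness** of `aPacketGOfOneDimU_ofOccurs …` (its `isDiscrete` field, by construction). [cite: Rogawski1990, §13.3 p. 201 ¶2] -/
theorem isDiscrete_aPacketGOfOneDimU_ofOccurs_fin : (aPacketGOfOneDimU_ofOccurs h8U hunrU ξ infOf aTok hAtok πn hmemN hsphN hoccN).1.fin.IsDiscrete μ :=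
  isDiscrete_imageG_rhoXiU_of_occurs h8U hunrU ξ πn hmemN hsphN hoccN

end APacketOcc

end Summit.HodgeConjecture.HodgeConjecture.R90.S5

end
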